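import Summits.CriticalPhenomena.PercolationContinuityZ3.Theorems.Transplant.SkelSign1Closure
import Summits.CriticalPhenomena.PercolationContinuityZ3.Theorems.Transplant.SkelConcChoice
import HarnessLib

/-!
# D″ node, option S: the (Z″) PARTIAL CLOSURE OF RECORD, SHARED-CHOICE FORM (DPRIME-SCOPE §2 L7′, addendum N; DP1/DP4) for the
# SINGLE-TYPE node `SamePDropOfSkeletonSign₁`: the instance's choices as ONE function of the handed
# constants and of the Step-I′ output (`PlanarSkeletonSign.ChoiceFn`), the three residues as three INDEPENDENT statements about it
# (`RootHoldsFn`, `FaceHoldsRFn`, `ReachHoldsRHFn`), and **`samePDropOfSkeletonSign₁_of_choiceFnRH`** — twin of the node of record's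
# `SkelConc.samePDropOfSkeletonConcLt_of_choiceFnRH` (SkelConcChoice, p-stmt lineage) with the D″ order of constants built in: the cells and
# the finite lists are functions of the Step-I′ data (fixed at the reference density), the fibre-radius schedule may also see the running density;
# the 8th Step-I′ fact (`MonoAbove`, `TwoUnitL`) is available to the admissibility field `S_adm` and to every `…Holds` through `AtQ`

builds on p205010 (kernel theorem, internal audit signed; external expert review pending) — nothing in this file uses p205010.
Lane `prim-bschramm`, seat `prim-bschramm-p3` (gen 7; D″ design owner); helper file (`--supports stmt-CriticalPhenomena-4575`).
* `Skelφ.StepI.Out V` — the Step-I′ output bundle `(D, off, M₀, n₁)`; `Out.Facts Φ hC m₀ O` — the seven facts of `exists_stepI`;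
* `SkelConc.Consts` (p-free handed constants `K₀ δ δ₂ δr`) is REUSED (it has no skeleton field);
* `PlanarSkeletonSign.Choice κ Φ t p hC` — `δI > 0`, `m₀`, finite lists `Sz Sx Sy : Out V → Finset ℕ` (admissible under the facts), two-unit cells
  `P : Out V → PCells2` (NO density argument: DP3/(r2)), schedule `Λ : Out V → unitInterval → ConcRadiiG`; `Choice.AtQ O q` (facts ∧ `q ∈ [p/2, p]` ∧
  the Step-I′ family over the lists at accuracy `δI` at `q` ∧ Φ2 at `q`), `Choice.scheme O q := ⟨Skelφ.cellGeomSG G Φ.φ (P O) t (Λ O q), q, κ.δ⟩`,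
  `.faces`; `WFHolds / RootHolds / FaceHoldsR / ReachHoldsRH`;
* `PlanarSkeletonSign.ChoiceFn` (for every `κ` and every admissible CENTRED ONE-TYPE `(G, Φ, t, p, hC)` of subexponential growth); `WFHoldsFn`, `RootHoldsFn`,
  `FaceHoldsRFn`, `ReachHoldsRHFn`; **`samePDropOfSkeletonSign₁_of_choiceFnRH (𝒞₀) (hWF) (hR) (hF) (hRe) : SamePDropOfSkeletonSign₁`**.
USE (L7′ params, then the three residue seats): define `signChoice₀ : ChoiceFn` (the constants ORDER of addendum N.3 — `L := ⌊A/17⌋`, `M_u := max M₀ n₁`,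
kit constants, `(eₓ, e_y)` from `TwoUnitL D 8 A L n₀`, `Sz := {M_u}`, `Sx := {M_u+1, ℓ1ˣ} ∪ Icc ℓ₀ˣ (L·eₓ + R')`, `Sy` dually, cells, schedule) +
`WFHoldsFn signChoice₀`; then `RootHoldsFn signChoice₀` ((R), p2), `FaceHoldsRFn signChoice₀` ((F), hp-8), `ReachHoldsRHFn signChoice₀` ((C), p5).
[cite: KozmaNitzan2024, §4 Theorem 6 (pp. 25–31); §1 p. 2 (approach 1)]
-/

noncomputable section

open MeasureTheory ProbabilityTheory
open scoped ENNReal Classical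

namespace Summit.CriticalPhenomena.PercolationContinuityZ3.Theorems.Transplant

open Literature.Probability.Percolation Literature.Probability.LatticeModels SimpleGraph KNCells
open Literature.Barriers.CriticalPhenomena (HasExponentialGrowth)
open BoxProdZ2 (ConcRadiiG)

/-! ## §1 The Step-I′ output bundle -/

namespace Skelφ.StepI

/-- **The output of Step I′** (`Skelφ.exists_stepI`): the data `D`, the seed offset `off`, the zone threshold `M₀`, the extent threshold `n₁`.
[this work] -/
structure Out (V : Type) where
  /-- the Step-I′ data (zone family, seed scale, fat radius, band half-widths) -/
  D : Data V
  /-- the seed offset -/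
  off : ℕ
  /-- admissible zone scales are `≥ M₀` -/
  M₀ : ℕ
  /-- admissible extents are `≥ n₁` -/
  n₁ : ℕ

variable {V : Type} {G : SimpleGraph V} [G.LocallyFinite]

/-- **The seven facts Step I′ guarantees about its output** (for a skeleton with frames `hfr` and Φ2 `hC`, least seed scale `m₀`). [this work] -/
def Out.Facts {φ : V → Site 2} {types : Finset V} [Countable V] (hfr : Frames G φ types) {p : unitInterval}
    (hC : CylSubcritical G φ types p) (m₀ : ℕ) (O : Out V) : Prop :=
  m₀ ≤ O.D.k ∧ 1 ≤ O.D.k ∧ O.D.R = fatRadius hfr hC ∧ O.D.Λ = fatSeqOff hfr hC O.off ∧ O.D.k < O.M₀ ∧ O.D.k < O.n₁ ∧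
    ∀ ℓ, O.D.k ≤ O.D.Gb ℓ ∧ O.D.k ≤ O.D.Fb ℓ

end Skelφ.StepI

/-! ## §2 Choices as data -/

namespace PlanarSkeletonSign

open SkelConc (Consts)

variable {V : Type} [DecidableEq V] [Countable V] {G : SimpleGraph V} [G.LocallyFinite]

/-- **The D″ instance's choices at a centred one-type `(Φ, t, p)`** for the constants `κ`: the Step-I′ accuracy and least seed scale, and — as functions
of the Step-I′ output — the finite scale lists, the two-unit planar cells (density-free) and the fibre-radius schedule. [this work] -/
structure Choice (κ : Consts) (Φ : PlanarSkeletonSign G) (t : V) (p : unitInterval) (hC : Φ.CylSubcritical p) where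
  /-- Step-I′ accuracy -/
  δI : ℝ
  /-- least seed scale asked of Step I′ -/
  m₀ : ℕ
  /-- the finite list of zone scales -/
  Sz : Skelφ.StepI.Out V → Finset ℕ
  /-- the finite list of `x`-extents -/
  Sx : Skelφ.StepI.Out V → Finset ℕ
  /-- the finite list of `y`-extents -/
  Sy : Skelφ.StepI.Out V → Finset ℕ
  /-- the two-unit planar cells (fixed at the reference density) -/
  P : Skelφ.StepI.Out V → PCells2
  /-- the fibre-radius schedule at the running density -/
  Λ : Skelφ.StepI.Out V → unitInterval → ConcRadiiG
  δI_pos : 0 < δI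
  S_adm : ∀ O : Skelφ.StepI.Out V, O.Facts Φ.frame hC m₀ → Skelφ.StepI.MonoAbove O.D → Skelφ.StepI.TwoUnitL O.D →
    (∀ M ∈ Sz O, O.M₀ ≤ M) ∧ (∀ ℓ ∈ Sx O, O.n₁ ≤ ℓ) ∧ (∀ ℓ ∈ Sy O, O.n₁ ≤ ℓ)

namespace Choice

variable {κ : Consts} {Φ : PlanarSkeletonSign G} {t : V} {p : unitInterval} {hC : Φ.CylSubcritical p}

/-- **The premises of step (B) at the running density `q`**: the Step-I′ facts about `O` (with the 8th fact), `q ∈ [p/2, p]`, the Step-I′ family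
(type `t`) over the chosen lists holds at `q` with accuracy `δI`, and Φ2 at `q`. [this work] -/
def AtQ (𝒞 : Choice κ Φ t p hC) (O : Skelφ.StepI.Out V) (q : unitInterval) : Prop :=
  O.Facts Φ.frame hC 𝒞.m₀ ∧ Skelφ.StepI.MonoAbove O.D ∧ Skelφ.StepI.TwoUnitL O.D ∧ (p : ℝ) / 2 ≤ q ∧ (q : ℝ) ≤ p ∧
    (∀ i ∈ Skelφ.StepI.index {t} (𝒞.Sz O) (𝒞.Sx O) (𝒞.Sy O),
      1 - 𝒞.δI < (bondPercolation G q).real (Skelφ.StepI.event G Φ.φ O.D i)) ∧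
    Φ.CylSubcritical q

/-- The chosen two-unit anchored-cells scheme at `q` (chain accuracy `κ.δ`). [this work] -/
abbrev scheme (𝒞 : Choice κ Φ t p hC) (O : Skelφ.StepI.Out V) (q : unitInterval) : KSchA V ℕ :=
  ⟨Skelφ.cellGeomSG G Φ.φ (𝒞.P O) t (𝒞.Λ O q), q, κ.δ⟩

/-- The chosen face data at `q`. [this work] -/
abbrev faces (𝒞 : Choice κ Φ t p hC) (O : Skelφ.StepI.Out V) (q : unitInterval) : FaceData V ℕ :=
  Skelφ.faceDataSG G Φ.φ (𝒞.P O) t (𝒞.Λ O q)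

/-- **Well-formedness of the choices**: `WFS2` and `≥ K₀` stub levels whenever `AtQ`. [this work] -/
def WFHolds (𝒞 : Choice κ Φ t p hC) : Prop :=
  ∀ (O : Skelφ.StepI.Out V) (q : unitInterval), 𝒞.AtQ O q → Skelφ.WFS2 (𝒞.P O) (𝒞.Λ O q) ∧ κ.K₀ ≤ (𝒞.P O).K

/-- **The root residue at the choices** ((R); KN §4 (32) at the root). [this work] -/
def RootHolds (𝒞 : Choice κ Φ t p hC) : Prop :=
  ∀ (O : Skelφ.StepI.Out V) (q : unitInterval), 𝒞.AtQ O q → Skel.RootOblT G (𝒞.scheme O q) Φ.Δ κ.δr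

/-- **The face residue at the choices, run-restricted form** ((F); KN §4 p. 30, Step III). [this work] -/
def FaceHoldsR (𝒞 : Choice κ Φ t p hC) : Prop :=
  ∀ (O : Skelφ.StepI.Out V) (q : unitInterval), 𝒞.AtQ O q → Skelφ.FaceOblR G Φ.φ (𝒞.scheme O q) (𝒞.faces O q) Φ.Δ κ.δ₂

/-- **The corridor residue at the choices, run-restricted habitat form** ((C); KN §4 p. 30, Step IV; Lemma 12′). [this work] -/
def ReachHoldsRH (𝒞 : Choice κ Φ t p hC) : Prop :=
  ∀ (O : Skelφ.StepI.Out V) (q : unitInterval), 𝒞.AtQ O q → Skel.ReachOblRH G (𝒞.scheme O q) (𝒞.faces O q) Φ.Δ κ.δ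

end Choice

/-- **A D″ choice function**: choices for every handed constants `κ` and every admissible CENTRED ONE-TYPE `(G, Φ, t, p, hC)` with `G` NOT of
exponential growth (`t ∈ Φ.types`, `Φ.types = {t}`, `Φ.φ t = 0`, `0 < p < 1`, Φ2 at `p`). [this work] -/
def ChoiceFn : Type 1 :=
  ∀ (κ : Consts) {V : Type} [DecidableEq V] [Countable V] (G : SimpleGraph V) [G.LocallyFinite] (Φ : PlanarSkeletonSign G),
    ¬ HasExponentialGrowth G → ∀ (t : V), t ∈ Φ.types → Φ.types = {t} → Φ.φ t = 0 → ∀ (p : unitInterval), 0 < (p : ℝ) → (p : ℝ) < 1 →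
      ∀ (hC : Φ.CylSubcritical p), Choice κ Φ t p hC

/-- The well-formedness obligation of a choice function. [this work] -/
def WFHoldsFn (𝒞₀ : ChoiceFn) : Prop :=
  ∀ (κ : Consts) {V : Type} [DecidableEq V] [Countable V] (G : SimpleGraph V) [G.LocallyFinite] (Φ : PlanarSkeletonSign G)
    (hg : ¬ HasExponentialGrowth G) (t : V) (ht : t ∈ Φ.types) (h1 : Φ.types = {t}) (h0 : Φ.φ t = 0) (p : unitInterval) (hp0 : 0 < (p : ℝ))
    (hp1 : (p : ℝ) < 1) (hC : Φ.CylSubcritical p), (𝒞₀ κ G Φ hg t ht h1 h0 p hp0 hp1 hC).WFHolds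

/-- **The root obligation of a choice function** ((R)). [this work] -/
def RootHoldsFn (𝒞₀ : ChoiceFn) : Prop :=
  ∀ (κ : Consts) {V : Type} [DecidableEq V] [Countable V] (G : SimpleGraph V) [G.LocallyFinite] (Φ : PlanarSkeletonSign G)
    (hg : ¬ HasExponentialGrowth G) (t : V) (ht : t ∈ Φ.types) (h1 : Φ.types = {t}) (h0 : Φ.φ t = 0) (p : unitInterval) (hp0 : 0 < (p : ℝ))
    (hp1 : (p : ℝ) < 1) (hC : Φ.CylSubcritical p), (𝒞₀ κ G Φ hg t ht h1 h0 p hp0 hp1 hC).RootHolds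

/-- **The face obligation of a choice function, run-restricted form** ((F)). [this work] -/
def FaceHoldsRFn (𝒞₀ : ChoiceFn) : Prop :=
  ∀ (κ : Consts) {V : Type} [DecidableEq V] [Countable V] (G : SimpleGraph V) [G.LocallyFinite] (Φ : PlanarSkeletonSign G)
    (hg : ¬ HasExponentialGrowth G) (t : V) (ht : t ∈ Φ.types) (h1 : Φ.types = {t}) (h0 : Φ.φ t = 0) (p : unitInterval) (hp0 : 0 < (p : ℝ))
    (hp1 : (p : ℝ) < 1) (hC : Φ.CylSubcritical p), (𝒞₀ κ G Φ hg t ht h1 h0 p hp0 hp1 hC).FaceHoldsR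

/-- **The corridor obligation of a choice function, run-restricted habitat form** ((C)). [this work] -/
def ReachHoldsRHFn (𝒞₀ : ChoiceFn) : Prop :=
  ∀ (κ : Consts) {V : Type} [DecidableEq V] [Countable V] (G : SimpleGraph V) [G.LocallyFinite] (Φ : PlanarSkeletonSign G)
    (hg : ¬ HasExponentialGrowth G) (t : V) (ht : t ∈ Φ.types) (h1 : Φ.types = {t}) (h0 : Φ.φ t = 0) (p : unitInterval) (hp0 : 0 < (p : ℝ))
    (hp1 : (p : ℝ) < 1) (hC : Φ.CylSubcritical p), (𝒞₀ κ G Φ hg t ht h1 h0 p hp0 hp1 hC).ReachHoldsRH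

/-! ## §3 The single-type node from a choice function -/

/-- **THE D″ PARTIAL CLOSURE OF RECORD, shared-choice form**: a choice function whose choices are well-formed and satisfy the root, face and
corridor obligations gives `SamePDropOfSkeletonSign₁` (through `samePDropOfSkeletonSign₁_of_concSG_residuesRH`; Step I′ with the 8th fact,
Hutchcroft, Burton–Keane, `p_c < 1`, the constants and the re-centring are all inside). [cite: KozmaNitzan2024, §4 Theorem 6 (pp. 25–31); §1 p. 2] -/
theorem samePDropOfSkeletonSign₁_of_choiceFnRH (𝒞₀ : ChoiceFn) (hWF : WFHoldsFn 𝒞₀) (hR : RootHoldsFn 𝒞₀) (hF : FaceHoldsRFn 𝒞₀)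
    (hRe : ReachHoldsRHFn 𝒞₀) : SamePDropOfSkeletonSign₁ := by
  refine samePDropOfSkeletonSign₁_of_concSG_residuesRH
    fun K₀ δ δ₂ δr hδ0 hδ1 hδ₂0 hδ₂1 hδr {V} _ _ G _ Φ hg t ht h1 h0 p hp0 hp1 hC => ?_
  set κ : Consts := ⟨K₀, δ, δ₂, δr, hδ0, hδ1, hδ₂0, hδ₂1, hδr⟩ with hκ
  set 𝒞 := 𝒞₀ κ G Φ hg t ht h1 h0 p hp0 hp1 hC with h𝒞
  refine ⟨𝒞.δI, 𝒞.m₀, 𝒞.δI_pos, fun D off M₀ n₁ hk₀ hk₁ hR' hΛ hM₀ hn₁ hGF hmono htwo => ?_⟩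
  set O : Skelφ.StepI.Out V := ⟨D, off, M₀, n₁⟩ with hO
  have hfacts : O.Facts Φ.frame hC 𝒞.m₀ := ⟨hk₀, hk₁, hR', hΛ, hM₀, hn₁, hGF⟩
  obtain ⟨hSz, hSx, hSy⟩ := 𝒞.S_adm O hfacts hmono htwo
  refine ⟨𝒞.Sz O, 𝒞.Sx O, 𝒞.Sy O, hSz, hSx, hSy, fun q hq1 hq2 hin hCq => ?_⟩
  have hat : 𝒞.AtQ O q := ⟨hfacts, hmono, htwo, hq1, hq2, hin, hCq⟩
  obtain ⟨hwf, hK⟩ := hWF κ G Φ hg t ht h1 h0 p hp0 hp1 hC O q hat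
  exact ⟨𝒞.P O, 𝒞.Λ O q, hwf, hK, hR κ G Φ hg t ht h1 h0 p hp0 hp1 hC O q hat, hF κ G Φ hg t ht h1 h0 p hp0 hp1 hC O q hat,
    hRe κ G Φ hg t ht h1 h0 p hp0 hp1 hC O q hat⟩

end PlanarSkeletonSign

end Summit.CriticalPhenomena.PercolationContinuityZ3.Theorems.Transplant

end
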